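import Literature.Barriers.Parity.SiegelZeroQuadraticPolynomialsTools
import Literature.NumberTheory.LFunctions.MertensElementary
import Mathlib.Analysis.Complex.ExponentialBounds
import HarnessLib

/-!
# `ω`-sums of `f_d` under the two exceptional-prime sparsity inputs, and the lower bound for `ϱ_d`

Topic `Literature/Barriers/Parity`, the arithmetic layer (§5C) of the proof of
`Literature.Barriers.Parity.GranvilleMollin2000_thm4` (Granville–Mollin, *Rabinowitsch revisited*,
Acta Arith. 96 (2000), Theorem 4) from the two named inputs of
`SiegelZeroQuadraticPolynomialsInputs.lean` (`GranvilleMollin2000_eq5_5'`: `∑_{p ≤ x} ω(p) log p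
≪ x log x/(η log q)` for `q^C ≤ x < q^η`; `GranvilleMollin2000_heathBrownLemma3`:
`∑_{p ≤ q^500} ω(p) log p/p ≪ log q/√(log η)`). Everything is PROVED; no definition is
introduced; the inputs enter only as inequalities in the hypotheses (`hH`, `hM`), so that the file
does not depend on the quantifier structure of the facts. Here `d = −q`, `q ≡ 3 (mod 8)`
(`d ≡ 5 (mod 8)`), `ω(p) = ω_{f_d}(p) = 1 + (p/q) ≤ 2`, `ω(2) = 0`
(`SiegelZeroQuadraticPolynomialsTools.lean`), `ϱ_d = ∏_{p ≤ √q} (1 − ω(p)/p)` (`gmRho`).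

* `sum_omega_div_window_le_of_weighted` — from `∑_{p ≤ B} ω(p) log p/p ≤ H` to
  `∑_{a < p ≤ b} ω(p)/p ≤ H/log w` for a window of primes `≥ w > 1` (the use of Heath-Brown's
  Lemma 3 in §5C: "(5.6)").
* `sum_omega_window_le_of_chebyshev`, `sum_omega_div_window_le_of_chebyshev` — from
  `∑_{p ≤ b} ω(p) log p ≤ M` to `∑_{x < p ≤ b} ω(p) ≤ M/log x` and `∑_{x < p ≤ b} ω(p)/p ≤ M/(x log x)`
  (the use of the display before (5.5) in §6B: "`∑_{x<p<2x} ω(p)/p ≪ 1/log(d^η)` for `x > d^C`").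
* `sum_dyadic_le` — dyadic summation of `∑ a(p) c(p)` over `(x, 2^J x]` against block bounds for
  `∑ a(p)` and block maxima of the weight `c` ("after some calculation", §6B).
* `log_gmRho_ge` — `log ϱ_d ≥ −∑_{p ≤ √q} ω(p)/p − 5` (second-order terms, from the Tools file).
* `gmRho_ge_of_weighted` — **the lower bound (5.8) in effective form**: if
  `∑_{p ≤ q^500} ω(p) log p/p ≤ K₁ log q/√(log η)` with `K₁ ≥ 1`, `log η ≥ 4K₁²` and `q ≥ 25`, then
  `ϱ_d ≥ e^{−25} min(1, log η/(K₁² log² q))` (split `∑_{p ≤ √q} ω(p)/p` at `q^a`,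
  `a = K₁/√(log η)`: Mertens below, Heath-Brown above; if `q^a < 2` the whole sum is `< 1`).
* `gmRho_le_prod_primesBelow`, `prod_primesBelow_le_gmRho_mul_exp` — for `5 ≤ y ≤ √q`:
  `ϱ_d ≤ V(y) = ∏_{p < y} (1 − ω(p)/p) ≤ ϱ_d exp(∑_{y ≤ p ≤ √q} ω(p)/p + 16/y)` (the comparison
  `∏_{p ≤ N/q}(1 − ω(p)/p) ∼ ϱ_d` of §6B).

[cite: GranvilleMollin2000, §5C (5.5)–(5.8) and §6B]
-/

noncomputable section

open Finset Real
open Literature.NumberTheory.Sieve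

namespace Literature.Barriers.Parity

/-! ### Window sums from weighted sums -/

/-- `ω(p) log p / p ≥ 0` termwise, so partial sums over subsets are bounded by the full sum. [folklore] -/
theorem omega_mul_log_div_nonneg (d : ℤ) (p : ℕ) :
    0 ≤ (polyRootCountMod ![rabinowitschPoly d] p : ℝ) * Real.log p / p := by
  rcases Nat.eq_zero_or_pos p with rfl | hp
  · simp
  · have : (1 : ℝ) ≤ p := by exact_mod_cast hp
    have hlog : 0 ≤ Real.log p := Real.log_nonneg this
    positivity

/-- **From Heath-Brown's weighted bound to a window** ((5.6) of Granville–Mollin): if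
`∑_{p ≤ B} ω(p) log p/p ≤ H` and every prime of the window `(a, b]`, `b ≤ B`, is `≥ w > 1`
(`w ≤ a + 1`), then `∑_{a < p ≤ b} ω(p)/p ≤ H/log w`. [cite: GranvilleMollin2000, §5C (5.6)] -/
theorem sum_omega_div_window_le_of_weighted {d : ℤ} {B a b : ℕ} {w H : ℝ} (hw : 1 < w)
    (hwa : w ≤ (a : ℝ) + 1) (hbB : b ≤ B)
    (hH : ∑ p ∈ Nat.primesLE B, (polyRootCountMod ![rabinowitschPoly d] p : ℝ) * Real.log p / p ≤ H) :
    ∑ p ∈ (Nat.primesLE b).filter (fun p => a < p), (polyRootCountMod ![rabinowitschPoly d] p : ℝ) / p ≤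
      H / Real.log w := by
  have hlogw : 0 < Real.log w := Real.log_pos hw
  have hsub : (Nat.primesLE b).filter (fun p => a < p) ⊆ Nat.primesLE B := fun p hp => by
    rw [mem_filter, Nat.mem_primesLE] at hp
    exact Nat.mem_primesLE.mpr ⟨hp.1.1.trans hbB, hp.1.2⟩
  have hterm : ∀ p ∈ (Nat.primesLE b).filter (fun p => a < p),
      (polyRootCountMod ![rabinowitschPoly d] p : ℝ) / p ≤
        ((polyRootCountMod ![rabinowitschPoly d] p : ℝ) * Real.log p / p) / Real.log w := by
    intro p hp
    rw [mem_filter, Nat.mem_primesLE] at hp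
    have hp1 : (a : ℝ) + 1 ≤ p := by exact_mod_cast hp.2
    have hwp : w ≤ p := hwa.trans hp1
    have hp0 : (0 : ℝ) < p := by linarith
    have hlogp : Real.log w ≤ Real.log p := Real.log_le_log (by linarith) hwp
    rw [le_div_iff₀ hlogw, div_mul_eq_mul_div]
    exact div_le_div_of_nonneg_right (mul_le_mul_of_nonneg_left hlogp (Nat.cast_nonneg _)) hp0.le
  calc ∑ p ∈ (Nat.primesLE b).filter (fun p => a < p), (polyRootCountMod ![rabinowitschPoly d] p : ℝ) / p
      ≤ ∑ p ∈ (Nat.primesLE b).filter (fun p => a < p),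
          ((polyRootCountMod ![rabinowitschPoly d] p : ℝ) * Real.log p / p) / Real.log w :=
        sum_le_sum hterm
    _ = (∑ p ∈ (Nat.primesLE b).filter (fun p => a < p),
          (polyRootCountMod ![rabinowitschPoly d] p : ℝ) * Real.log p / p) / Real.log w := by
        rw [sum_div]
    _ ≤ (∑ p ∈ Nat.primesLE B, (polyRootCountMod ![rabinowitschPoly d] p : ℝ) * Real.log p / p) /
          Real.log w :=
        div_le_div_of_nonneg_right
          (sum_le_sum_of_subset_of_nonneg hsub fun p _ _ => omega_mul_log_div_nonneg d p) hlogw.le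
    _ ≤ H / Real.log w := div_le_div_of_nonneg_right hH hlogw.le

/-- **From a Chebyshev-type bound to a window count** (the use of the display before (5.5) in
§6B): if `∑_{p ≤ b} ω(p) log p ≤ M` and `x > 1`, then `∑_{⌊x⌋ < p ≤ b} ω(p) ≤ M/log x`.
[cite: GranvilleMollin2000, §5C (display before (5.5)) and §6B] -/
theorem sum_omega_window_le_of_chebyshev {d : ℤ} {b : ℕ} {x M : ℝ} (hx : 1 < x)
    (hM : ∑ p ∈ Nat.primesLE b, (polyRootCountMod ![rabinowitschPoly d] p : ℝ) * Real.log p ≤ M) :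
    ∑ p ∈ (Nat.primesLE b).filter (fun p => ⌊x⌋₊ < p), (polyRootCountMod ![rabinowitschPoly d] p : ℝ) ≤
      M / Real.log x := by
  have hlogx : 0 < Real.log x := Real.log_pos hx
  have hterm : ∀ p ∈ (Nat.primesLE b).filter (fun p => ⌊x⌋₊ < p),
      (polyRootCountMod ![rabinowitschPoly d] p : ℝ) ≤
        ((polyRootCountMod ![rabinowitschPoly d] p : ℝ) * Real.log p) / Real.log x := by
    intro p hp
    rw [mem_filter] at hp
    have hxp : x < p := (Nat.floor_lt (by linarith)).mp hp.2
    have hlogp : Real.log x ≤ Real.log p := Real.log_le_log (by linarith) hxp.le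
    rw [le_div_iff₀ hlogx]
    exact mul_le_mul_of_nonneg_left hlogp (Nat.cast_nonneg _)
  have hnn : ∀ p ∈ Nat.primesLE b, 0 ≤ (polyRootCountMod ![rabinowitschPoly d] p : ℝ) * Real.log p :=
    fun p hp => mul_nonneg (Nat.cast_nonneg _)
      (Real.log_nonneg (by exact_mod_cast (Nat.prime_of_mem_primesLE hp).one_lt.le))
  calc ∑ p ∈ (Nat.primesLE b).filter (fun p => ⌊x⌋₊ < p), (polyRootCountMod ![rabinowitschPoly d] p : ℝ)
      ≤ ∑ p ∈ (Nat.primesLE b).filter (fun p => ⌊x⌋₊ < p),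
          ((polyRootCountMod ![rabinowitschPoly d] p : ℝ) * Real.log p) / Real.log x := sum_le_sum hterm
    _ = (∑ p ∈ (Nat.primesLE b).filter (fun p => ⌊x⌋₊ < p),
          (polyRootCountMod ![rabinowitschPoly d] p : ℝ) * Real.log p) / Real.log x := by rw [sum_div]
    _ ≤ (∑ p ∈ Nat.primesLE b, (polyRootCountMod ![rabinowitschPoly d] p : ℝ) * Real.log p) / Real.log x :=
        div_le_div_of_nonneg_right
          (sum_le_sum_of_subset_of_nonneg (filter_subset _ _) fun p hp _ => hnn p hp) hlogx.le
    _ ≤ M / Real.log x := div_le_div_of_nonneg_right hM hlogx.le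

/-- The same for `ω(p)/p`: `∑_{⌊x⌋ < p ≤ b} ω(p)/p ≤ M/(x log x)` (`1/p < 1/x` on the window).
[cite: GranvilleMollin2000, §6B] -/
theorem sum_omega_div_window_le_of_chebyshev {d : ℤ} {b : ℕ} {x M : ℝ} (hx : 1 < x)
    (hM : ∑ p ∈ Nat.primesLE b, (polyRootCountMod ![rabinowitschPoly d] p : ℝ) * Real.log p ≤ M) :
    ∑ p ∈ (Nat.primesLE b).filter (fun p => ⌊x⌋₊ < p), (polyRootCountMod ![rabinowitschPoly d] p : ℝ) / p ≤
      M / (x * Real.log x) := by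
  have hx0 : 0 < x := by linarith
  have hlogx : 0 < Real.log x := Real.log_pos hx
  have h1 := sum_omega_window_le_of_chebyshev (d := d) hx hM
  have hM0 : 0 ≤ M / Real.log x :=
    le_trans (sum_nonneg fun p _ => Nat.cast_nonneg _) h1
  calc ∑ p ∈ (Nat.primesLE b).filter (fun p => ⌊x⌋₊ < p), (polyRootCountMod ![rabinowitschPoly d] p : ℝ) / p
      ≤ ∑ p ∈ (Nat.primesLE b).filter (fun p => ⌊x⌋₊ < p),
          (polyRootCountMod ![rabinowitschPoly d] p : ℝ) / x := by
        refine sum_le_sum fun p hp => ?_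
        rw [mem_filter] at hp
        have hxp : x < p := (Nat.floor_lt hx0.le).mp hp.2
        exact div_le_div_of_nonneg_left (Nat.cast_nonneg _) hx0 hxp.le
    _ = (∑ p ∈ (Nat.primesLE b).filter (fun p => ⌊x⌋₊ < p),
          (polyRootCountMod ![rabinowitschPoly d] p : ℝ)) / x := by rw [sum_div]
    _ ≤ (M / Real.log x) / x := div_le_div_of_nonneg_right h1 hx0.le
    _ = M / (x * Real.log x) := by rw [div_div, mul_comm]

/-! ### Dyadic summation -/

/-- **Dyadic summation** ("after some calculation", §6B): for `a ≥ 0`, `x ≥ 0` and weights `c`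
bounded on the `j`-th block `(2^j x, 2^{j+1} x]` by `W_j ≥ 0`, block bounds `∑_{block j} a(p) ≤ B_j`
give `∑_{x < p ≤ 2^J x} a(p) c(p) ≤ ∑_{j < J} W_j B_j` (sums over primes). [folklore] -/
theorem sum_dyadic_le {a c : ℕ → ℝ} (ha : ∀ p, 0 ≤ a p) {x : ℝ} (hx : 0 ≤ x) {B W : ℕ → ℝ} (J : ℕ)
    (hB : ∀ j < J, ∑ p ∈ (Nat.primesLE ⌊(2 : ℝ) ^ (j + 1) * x⌋₊).filter
      (fun p => ⌊(2 : ℝ) ^ j * x⌋₊ < p), a p ≤ B j)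
    (hW : ∀ j < J, ∀ p ∈ (Nat.primesLE ⌊(2 : ℝ) ^ (j + 1) * x⌋₊).filter
      (fun p => ⌊(2 : ℝ) ^ j * x⌋₊ < p), c p ≤ W j)
    (hW0 : ∀ j < J, 0 ≤ W j) :
    ∑ p ∈ (Nat.primesLE ⌊(2 : ℝ) ^ J * x⌋₊).filter (fun p => ⌊x⌋₊ < p), a p * c p ≤
      ∑ j ∈ range J, W j * B j := by
  induction J with
  | zero =>
    rw [sum_range_zero, pow_zero, one_mul]
    have : (Nat.primesLE ⌊x⌋₊).filter (fun p => ⌊x⌋₊ < p) = ∅ := by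
      ext p
      simp only [mem_filter, Nat.mem_primesLE, Finset.notMem_empty, iff_false, not_and, not_lt]
      exact fun h => h.1
    rw [this, sum_empty]
  | succ J ih =>
    have hmono : ∀ j : ℕ, ⌊(2 : ℝ) ^ j * x⌋₊ ≤ ⌊(2 : ℝ) ^ (j + 1) * x⌋₊ := fun j =>
      Nat.floor_le_floor (mul_le_mul_of_nonneg_right
        (pow_le_pow_right₀ (by norm_num) (Nat.le_succ j)) hx)
    have hx1 : ⌊x⌋₊ ≤ ⌊(2 : ℝ) ^ J * x⌋₊ := by
      refine Nat.floor_le_floor ?_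
      calc x = 1 * x := (one_mul x).symm
        _ ≤ (2 : ℝ) ^ J * x := mul_le_mul_of_nonneg_right (one_le_pow₀ (by norm_num)) hx
    rw [sum_primesLE_filter_lt_split hx1 (hmono J), sum_range_succ]
    refine add_le_add (ih (fun j hj => hB j (Nat.lt_succ_of_lt hj))
      (fun j hj => hW j (Nat.lt_succ_of_lt hj)) (fun j hj => hW0 j (Nat.lt_succ_of_lt hj))) ?_
    have hJ := Nat.lt_succ_self J
    calc ∑ p ∈ (Nat.primesLE ⌊(2 : ℝ) ^ (J + 1) * x⌋₊).filter (fun p => ⌊(2 : ℝ) ^ J * x⌋₊ < p),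
          a p * c p
        ≤ ∑ p ∈ (Nat.primesLE ⌊(2 : ℝ) ^ (J + 1) * x⌋₊).filter (fun p => ⌊(2 : ℝ) ^ J * x⌋₊ < p),
          a p * W J := sum_le_sum fun p hp => mul_le_mul_of_nonneg_left (hW J hJ p hp) (ha p)
      _ = (∑ p ∈ (Nat.primesLE ⌊(2 : ℝ) ^ (J + 1) * x⌋₊).filter (fun p => ⌊(2 : ℝ) ^ J * x⌋₊ < p),
          a p) * W J := by rw [sum_mul]
      _ ≤ B J * W J := mul_le_mul_of_nonneg_right (hB J hJ) (hW0 J hJ)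
      _ = W J * B J := mul_comm _ _

/-! ### The lower bound for `ϱ_d` -/

/-- **Second-order terms**: for `q ≡ 3 (mod 8)` and `X ≥ 4`,
`∑_{p ≤ X} log(1 − ω(p)/p) ≥ −∑_{p ≤ X} ω(p)/p − 5` (`p = 2`: `ω = 0`; `p = 3`: `log(1/3) ≥ −1.4`;
`p ≥ 5`: the Tools bound `16/5`). [folklore] -/
theorem sum_log_one_sub_omega_ge {d : ℤ} {q : ℕ} (hdq : d = -(q : ℤ)) (hq8 : q % 8 = 3) {X : ℕ}
    (hX : 4 ≤ X) :
    -(∑ p ∈ Nat.primesLE X, (polyRootCountMod ![rabinowitschPoly d] p : ℝ) / p) - 5 ≤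
      ∑ p ∈ Nat.primesLE X, Real.log (1 - (polyRootCountMod ![rabinowitschPoly d] p : ℝ) / p) := by
  have hq4 : q % 4 = 3 := by omega
  set g : ℕ → ℝ := fun p => Real.log (1 - (polyRootCountMod ![rabinowitschPoly d] p : ℝ) / p) +
    (polyRootCountMod ![rabinowitschPoly d] p : ℝ) / p with hg
  have hsum : ∑ p ∈ Nat.primesLE X, g p =
      ∑ p ∈ Nat.primesLE X, Real.log (1 - (polyRootCountMod ![rabinowitschPoly d] p : ℝ) / p) +
        ∑ p ∈ Nat.primesLE X, (polyRootCountMod ![rabinowitschPoly d] p : ℝ) / p := by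
    rw [hg, sum_add_distrib]
  -- split at `4`
  have hsplit : ∑ p ∈ Nat.primesLE X, g p =
      ∑ p ∈ Nat.primesLE 4, g p + ∑ p ∈ (Nat.primesLE X).filter (fun p => 4 < p), g p := by
    rw [sum_primesLE_filter_lt hX]; ring
  have htail : -(16 / ((4 : ℕ) + 1 : ℝ)) ≤ ∑ p ∈ (Nat.primesLE X).filter (fun p => 4 < p), g p :=
    (abs_le.mp (abs_sum_log_one_sub_omega_add_le hdq hq4 (s := 4) (X := X) le_rfl)).1
  have h4 : Nat.primesLE 4 = {2, 3} := by decide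
  have hg2 : g 2 = 0 := by
    simp only [hg, polyRootCountMod_rabinowitschPoly_two_eq_zero hdq hq8, Nat.cast_zero, zero_div,
      sub_zero, Real.log_one, add_zero]
  have hg3 : -(7 / 5 : ℝ) ≤ g 3 := by
    have hω : (polyRootCountMod ![rabinowitschPoly d] 3 : ℝ) ≤ 2 := by
      exact_mod_cast polyRootCountMod_rabinowitschPoly_le_two hdq hq4 Nat.prime_three
    have hω0 : (0 : ℝ) ≤ polyRootCountMod ![rabinowitschPoly d] 3 := Nat.cast_nonneg _
    have h13 : (1 : ℝ) / 3 ≤ 1 - (polyRootCountMod ![rabinowitschPoly d] 3 : ℝ) / (3 : ℕ) := by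
      push_cast
      have : (polyRootCountMod ![rabinowitschPoly d] 3 : ℝ) / 3 ≤ 2 / 3 :=
        div_le_div_of_nonneg_right hω (by norm_num)
      linarith
    have hlog : Real.log (1 / 3) ≤
        Real.log (1 - (polyRootCountMod ![rabinowitschPoly d] 3 : ℝ) / (3 : ℕ)) :=
      Real.log_le_log (by norm_num) h13
    have hl3 : Real.log (1 / 3 : ℝ) = -Real.log 3 := by
      rw [one_div, Real.log_inv]
    have hlt := Real.log_three_lt_d9
    have hdiv0 : (0 : ℝ) ≤ (polyRootCountMod ![rabinowitschPoly d] 3 : ℝ) / (3 : ℕ) := by positivity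
    simp only [hg]
    linarith
  have hhead : -(7 / 5 : ℝ) ≤ ∑ p ∈ Nat.primesLE 4, g p := by
    rw [h4, sum_insert (by decide), sum_singleton, hg2, zero_add]
    exact hg3
  have htot : -(5 : ℝ) ≤ ∑ p ∈ Nat.primesLE X, g p := by
    rw [hsplit]
    have : -(16 / ((4 : ℕ) + 1 : ℝ)) = -(16 / 5) := by norm_num
    linarith
  linarith

/-- **`log ϱ_d ≥ −∑_{p ≤ √q} ω(p)/p − 5`** for `q ≡ 3 (mod 8)`, `q ≥ 16`. [cite: GranvilleMollin2000, §5C (5.8)] -/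
theorem log_gmRho_ge {d : ℤ} {q : ℕ} (hdq : d = -(q : ℤ)) (hq8 : q % 8 = 3) (hq16 : 16 ≤ q) :
    -(∑ p ∈ Nat.primesLE ⌊Real.sqrt q⌋₊, (polyRootCountMod ![rabinowitschPoly d] p : ℝ) / p) - 5 ≤
      Real.log (gmRho d) := by
  have hq : (q : ℤ) = |d| := by rw [hdq, abs_neg, Nat.abs_cast]
  have hX : 4 ≤ ⌊Real.sqrt q⌋₊ := by
    refine Nat.le_floor ?_
    rw [show ((4 : ℕ) : ℝ) = Real.sqrt 16 by
      rw [show (16 : ℝ) = 4 ^ 2 by norm_num, Real.sqrt_sq (by norm_num)]; norm_num]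
    exact Real.sqrt_le_sqrt (by exact_mod_cast hq16)
  rw [gmRho_eq_prod hq, Real.log_prod (s := Nat.primesLE ⌊Real.sqrt q⌋₊) fun p hp =>
    (one_sub_omega_div_pos hdq hq8 (Nat.prime_of_mem_primesLE hp)).ne']
  exact sum_log_one_sub_omega_ge hdq hq8 hX

/-- `∑_{p ≤ m} ω(p)/p ≤ 2 (log log m + 4)` for `m ≥ 2` (`ω ≤ 2` and Mertens). [folklore] -/
theorem sum_omega_div_le_loglog {d : ℤ} {q : ℕ} (hdq : d = -(q : ℤ)) (hq4 : q % 4 = 3) {m : ℕ}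
    (hm : 2 ≤ m) :
    ∑ p ∈ Nat.primesLE m, (polyRootCountMod ![rabinowitschPoly d] p : ℝ) / p ≤
      2 * (Real.log (Real.log m) + 4) := by
  have h1 := Literature.NumberTheory.LFunctions.MertensBound.sum_inv_prime_le m hm
  calc ∑ p ∈ Nat.primesLE m, (polyRootCountMod ![rabinowitschPoly d] p : ℝ) / p
      ≤ ∑ p ∈ Nat.primesLE m, 2 * ((1 : ℝ) / p) := by
        refine sum_le_sum fun p hp => ?_
        have hprime := Nat.prime_of_mem_primesLE hp
        have hp0 : (0 : ℝ) < p := by exact_mod_cast hprime.pos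
        have h2 : (polyRootCountMod ![rabinowitschPoly d] p : ℝ) ≤ 2 := by
          exact_mod_cast polyRootCountMod_rabinowitschPoly_le_two hdq hq4 hprime
        rw [mul_one_div]
        exact div_le_div_of_nonneg_right h2 hp0.le
    _ = 2 * ∑ p ∈ Nat.primesLE m, (1 : ℝ) / p := by rw [mul_sum]
    _ ≤ 2 * (Real.log (Real.log m) + 4) := mul_le_mul_of_nonneg_left h1 (by norm_num)

/-- **The lower bound for `ϱ_d` under a Siegel zero** ((5.8) of Granville–Mollin, effective form):
for `q ≡ 3 (mod 8)`, `q ≥ 25`, `K₁ ≥ 1`, `log η ≥ 4 K₁²`, the Heath-Brown bound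
`∑_{p ≤ q^500} ω(p) log p/p ≤ K₁ log q/√(log η)` implies `ϱ_d ≥ e^{−25} min(1, log η/(K₁² log² q))`.
Proof: with `a = K₁/√(log η) ≤ 1/2`, if `q^a ≥ 2` split `∑_{p ≤ √q} ω(p)/p` at `q^a` — below,
`2 log log q^a + 8 = 2 log(a log q) + 8` (Mertens); above, `≤ K₁ log q/(√(log η) · a log q) = 1`
(Heath-Brown) — so `log ϱ_d ≥ −2 log(a log q) − 14`; if `q^a < 2` the whole sum is
`≤ (1/log 2) K₁ log q/√(log η) = a log q/log 2 < 1`. [cite: GranvilleMollin2000, §5C (5.8)] -/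
theorem gmRho_ge_of_weighted {d : ℤ} {q : ℕ} (hdq : d = -(q : ℤ)) (hq8 : q % 8 = 3) (hq25 : 25 ≤ q)
    {K₁ η : ℝ} (hK₁ : 1 ≤ K₁) (hη : 4 * K₁ ^ 2 ≤ Real.log η)
    (hH : ∑ p ∈ Nat.primesLE ⌊(q : ℝ) ^ (500 : ℝ)⌋₊,
        (polyRootCountMod ![rabinowitschPoly d] p : ℝ) * Real.log p / p ≤
      K₁ * (Real.log q / Real.sqrt (Real.log η))) :
    Real.exp (-25) * min 1 (Real.log η / (K₁ ^ 2 * Real.log q ^ 2)) ≤ gmRho d := by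
  have hq4 : q % 4 = 3 := by omega
  have hq16 : 16 ≤ q := by omega
  have hqR : (25 : ℝ) ≤ q := by exact_mod_cast hq25
  have hq0 : (0 : ℝ) < q := by linarith
  have hq1 : (1 : ℝ) < q := by linarith
  set L := Real.log q with hL
  have hL0 : 0 < L := Real.log_pos hq1
  have hL3 : 3 ≤ L := by
    -- `log 25 = 2 log 5 ≥ 3`: use `exp 3 ≤ 25`? via `exp 1 < 2.72`
    have h1 : Real.exp 1 < 2.7182818286 := Real.exp_one_lt_d9
    have h3 : Real.exp 3 = Real.exp 1 ^ 3 := by rw [← Real.exp_nat_mul]; norm_num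
    have hexp3 : Real.exp 3 ≤ 25 := by
      rw [h3]
      have h0 : 0 ≤ Real.exp 1 := (Real.exp_pos 1).le
      have h := pow_le_pow_left₀ h0 h1.le 3
      have : (2.7182818286 : ℝ) ^ 3 ≤ 25 := by norm_num
      exact h.trans this
    rw [hL, Real.le_log_iff_exp_le hq0]
    exact hexp3.trans hqR
  set s := Real.sqrt (Real.log η) with hs
  have hK0 : 0 < K₁ := by linarith
  have hlogη : 0 < Real.log η := by nlinarith
  have hs0 : 0 < s := Real.sqrt_pos.mpr hlogη
  have hs2 : s ^ 2 = Real.log η := Real.sq_sqrt hlogη.le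
  have hsK : 2 * K₁ ≤ s := by
    rw [hs, show 2 * K₁ = Real.sqrt ((2 * K₁) ^ 2) by rw [Real.sqrt_sq (by linarith)]]
    exact Real.sqrt_le_sqrt (by nlinarith)
  set a := K₁ / s with ha
  have ha0 : 0 < a := div_pos hK0 hs0
  have ha2 : a ≤ 1 / 2 := by
    rw [ha, div_le_iff₀ hs0]; linarith
  -- the quantity to bound and the target
  set S := ∑ p ∈ Nat.primesLE ⌊Real.sqrt q⌋₊, (polyRootCountMod ![rabinowitschPoly d] p : ℝ) / p
    with hS
  have hlogρ := log_gmRho_ge hdq hq8 hq16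
  have hρ0 : 0 < gmRho d := gmRho_pos hdq hq8
  have hmin1 : min 1 (Real.log η / (K₁ ^ 2 * L ^ 2)) ≤ 1 := min_le_left _ _
  have hmin0 : 0 ≤ min 1 (Real.log η / (K₁ ^ 2 * L ^ 2)) := le_min zero_le_one (by positivity)
  -- `X = ⌊√q⌋ ≤ ⌊q^500⌋`
  have hsqrt_le : Real.sqrt q ≤ (q : ℝ) ^ (500 : ℝ) := by
    rw [Real.sqrt_eq_rpow]
    exact Real.rpow_le_rpow_of_exponent_le hq1.le (by norm_num)
  have hXB : ⌊Real.sqrt q⌋₊ ≤ ⌊(q : ℝ) ^ (500 : ℝ)⌋₊ := Nat.floor_le_floor hsqrt_le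
  by_cases hcase : Real.log 2 ≤ a * L
  · -- Regime A: split at `m = ⌊q^a⌋ ≥ 2`
    have hqa2 : (2 : ℝ) ≤ (q : ℝ) ^ a := by
      rw [Real.le_rpow_iff_log_le (by norm_num) hq0]; rw [hL] at hcase; linarith
    set m : ℕ := ⌊(q : ℝ) ^ a⌋₊ with hm
    have hm2 : 2 ≤ m := Nat.le_floor (by exact_mod_cast hqa2)
    have hqa_le_sqrt : (q : ℝ) ^ a ≤ Real.sqrt q := by
      rw [Real.sqrt_eq_rpow]
      exact Real.rpow_le_rpow_of_exponent_le hq1.le ha2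
    have hmX : m ≤ ⌊Real.sqrt q⌋₊ := Nat.floor_le_floor hqa_le_sqrt
    have hsplit : S = ∑ p ∈ Nat.primesLE m, (polyRootCountMod ![rabinowitschPoly d] p : ℝ) / p +
        ∑ p ∈ (Nat.primesLE ⌊Real.sqrt q⌋₊).filter (fun p => m < p),
          (polyRootCountMod ![rabinowitschPoly d] p : ℝ) / p := by
      rw [hS, sum_primesLE_filter_lt hmX]; ring
    -- low part: Mertens
    have hlow := sum_omega_div_le_loglog hdq hq4 hm2
    have hmR : (m : ℝ) ≤ (q : ℝ) ^ a := Nat.floor_le (by positivity)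
    have hm1 : (1 : ℝ) < m := by exact_mod_cast hm2
    have hlogm : Real.log m ≤ a * L := by
      calc Real.log m ≤ Real.log ((q : ℝ) ^ a) := Real.log_le_log (by linarith) hmR
        _ = a * L := by rw [Real.log_rpow hq0, hL]
    have hlogm0 : 0 < Real.log m := Real.log_pos hm1
    have hloglog : Real.log (Real.log m) ≤ Real.log (a * L) := Real.log_le_log hlogm0 hlogm
    -- high part: Heath-Brown with `w = q^a`
    have hw1 : (1 : ℝ) < (q : ℝ) ^ a := by linarith
    have hwa : (q : ℝ) ^ a ≤ (m : ℝ) + 1 := (Nat.lt_floor_add_one _).le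
    have hhigh := sum_omega_div_window_le_of_weighted (d := d) hw1 hwa hXB hH
    have hlogw : Real.log ((q : ℝ) ^ a) = a * L := by rw [Real.log_rpow hq0, hL]
    rw [hlogw] at hhigh
    have hhigh1 : K₁ * (L / s) / (a * L) = 1 := by
      rw [ha]; field_simp
    rw [hhigh1] at hhigh
    -- assemble: `S ≤ 2 log(aL) + 9`, `log ϱ ≥ -2 log(aL) - 14`
    have hSle : S ≤ 2 * Real.log (a * L) + 9 := by rw [hsplit]; linarith
    have haL0 : 0 < a * L := by positivity
    have hlogρ' : -2 * Real.log (a * L) - 14 ≤ Real.log (gmRho d) := by linarith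
    have hkey : Real.exp (-14) / (a * L) ^ 2 ≤ gmRho d := by
      have : Real.exp (-2 * Real.log (a * L) - 14) = Real.exp (-14) / (a * L) ^ 2 := by
        rw [show -2 * Real.log (a * L) - 14 = -14 - 2 * Real.log (a * L) by ring, Real.exp_sub,
          show 2 * Real.log (a * L) = Real.log (a * L) * 2 by ring, Real.exp_mul, Real.exp_log haL0,
          Real.rpow_two]
      rw [← this, ← Real.exp_log hρ0]
      exact Real.exp_le_exp.mpr hlogρ'
    -- `(aL)² = K₁² L²/log η`
    have haL : (a * L) ^ 2 = K₁ ^ 2 * L ^ 2 / Real.log η := by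
      rw [ha, ← hs2]; field_simp
    have hval : Real.exp (-14) / (a * L) ^ 2 = Real.exp (-14) * (Real.log η / (K₁ ^ 2 * L ^ 2)) := by
      rw [haL]; field_simp
    rw [hval] at hkey
    calc Real.exp (-25) * min 1 (Real.log η / (K₁ ^ 2 * L ^ 2))
        ≤ Real.exp (-14) * (Real.log η / (K₁ ^ 2 * L ^ 2)) := by
          refine le_trans (mul_le_mul_of_nonneg_left (min_le_right _ _) (Real.exp_pos _).le) ?_
          exact mul_le_mul_of_nonneg_right (Real.exp_le_exp.mpr (by norm_num)) (by positivity)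
      _ ≤ gmRho d := hkey
  · -- Regime B: `q^a < 2`; the whole sum is `< 1`
    have hcase' : a * L < Real.log 2 := not_le.mp hcase
    have hw : (1 : ℝ) < 2 := by norm_num
    have hwa : (2 : ℝ) ≤ ((1 : ℕ) : ℝ) + 1 := by norm_num
    have hall := sum_omega_div_window_le_of_weighted (d := d) (a := 1) hw hwa hXB hH
    have hfilter : (Nat.primesLE ⌊Real.sqrt q⌋₊).filter (fun p => 1 < p) = Nat.primesLE ⌊Real.sqrt q⌋₊ :=
      filter_true_of_mem fun p hp => (Nat.prime_of_mem_primesLE hp).one_lt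
    rw [hfilter] at hall
    have hlog2 : (0.6931471803 : ℝ) < Real.log 2 := Real.log_two_gt_d9
    have hbound : K₁ * (L / s) / Real.log 2 < 1 := by
      rw [div_lt_one (by linarith)]
      have : K₁ * (L / s) = a * L := by rw [ha]; field_simp
      rw [this]; exact hcase'
    have hSle : S < 1 := lt_of_le_of_lt hall hbound
    have hlogρ' : -6 ≤ Real.log (gmRho d) := by linarith
    have hkey : Real.exp (-6) ≤ gmRho d := by
      rw [← Real.exp_log hρ0]; exact Real.exp_le_exp.mpr hlogρ'
    calc Real.exp (-25) * min 1 (Real.log η / (K₁ ^ 2 * L ^ 2)) ≤ Real.exp (-25) * 1 :=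
          mul_le_mul_of_nonneg_left hmin1 (Real.exp_pos _).le
      _ ≤ Real.exp (-6) := by rw [mul_one]; exact Real.exp_le_exp.mpr (by norm_num)
      _ ≤ gmRho d := hkey

/-! ### `V(y) = ∏_{p < y} (1 − ω(p)/p)` against `ϱ_d` -/

/-- `∏_{p < y} = ∏_{p ≤ ⌈y⌉ − 1}` (Mathlib's `primesBelow_eq_primesLE_sub_one`) and, for `y ≤ √q`,
`⌈y⌉ − 1 ≤ ⌊√q⌋`. [folklore] -/
theorem ceil_sub_one_le_floor_sqrt {q : ℕ} {y : ℝ} (hy : y ≤ Real.sqrt q) : ⌈y⌉₊ - 1 ≤ ⌊Real.sqrt q⌋₊ := by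
  have h1 : ⌈y⌉₊ ≤ ⌈Real.sqrt q⌉₊ := Nat.ceil_mono hy
  have h2 : ⌈Real.sqrt q⌉₊ ≤ ⌊Real.sqrt q⌋₊ + 1 := Nat.ceil_le_floor_add_one _
  omega

/-- **`ϱ_d ≤ V(y)`** for `y ≤ √q`, `q ≡ 3 (mod 8)`: the factors `y ≤ p ≤ √q` lie in `(0, 1]`.
[cite: GranvilleMollin2000, §6B] -/
theorem gmRho_le_prod_primesBelow {d : ℤ} {q : ℕ} (hdq : d = -(q : ℤ)) (hq8 : q % 8 = 3) {y : ℝ}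
    (hy : y ≤ Real.sqrt q) :
    gmRho d ≤ ∏ p ∈ Nat.primesBelow ⌈y⌉₊, (1 - (polyRootCountMod ![rabinowitschPoly d] p : ℝ) / p) := by
  have hq : (q : ℤ) = |d| := by rw [hdq, abs_neg, Nat.abs_cast]
  have hs := ceil_sub_one_le_floor_sqrt (q := q) hy
  rw [gmRho_eq_prod hq, prod_primesLE_eq_mul_prod_filter_lt hs, Nat.primesBelow_eq_primesLE_sub_one]
  refine mul_le_of_le_one_right (prod_nonneg fun p hp =>
    (one_sub_omega_div_pos hdq hq8 (Nat.prime_of_mem_primesLE hp)).le) ?_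
  refine prod_le_one (fun p hp => (one_sub_omega_div_pos hdq hq8
    (Nat.prime_of_mem_primesLE (mem_filter.mp hp).1)).le) fun p _ => ?_
  have : (0 : ℝ) ≤ (polyRootCountMod ![rabinowitschPoly d] p : ℝ) / p := by positivity
  linarith

/-- **`V(y) ≤ ϱ_d exp(T + 16/y)`** for `5 ≤ y ≤ √q`, `q ≡ 3 (mod 8)`, where `T` bounds the window
sum `∑_{⌈y⌉ − 1 < p ≤ ⌊√q⌋} ω(p)/p` (i.e. over the primes `y ≤ p ≤ √q`):
`∏_{y ≤ p ≤ √q} (1 − ω(p)/p) ≥ exp(−T − 16/y)`. [cite: GranvilleMollin2000, §6B with §5C (5.6)] -/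
theorem prod_primesBelow_le_gmRho_mul_exp {d : ℤ} {q : ℕ} (hdq : d = -(q : ℤ)) (hq8 : q % 8 = 3)
    {y T : ℝ} (hy5 : 5 ≤ y) (hy : y ≤ Real.sqrt q)
    (hT : ∑ p ∈ (Nat.primesLE ⌊Real.sqrt q⌋₊).filter (fun p => ⌈y⌉₊ - 1 < p),
        (polyRootCountMod ![rabinowitschPoly d] p : ℝ) / p ≤ T) :
    ∏ p ∈ Nat.primesBelow ⌈y⌉₊, (1 - (polyRootCountMod ![rabinowitschPoly d] p : ℝ) / p) ≤
      gmRho d * Real.exp (T + 16 / y) := by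
  have hq : (q : ℤ) = |d| := by rw [hdq, abs_neg, Nat.abs_cast]
  have hq4 : q % 4 = 3 := by omega
  have hs := ceil_sub_one_le_floor_sqrt (q := q) hy
  set s : ℕ := ⌈y⌉₊ - 1 with hs_def
  have hs4 : 4 ≤ s := by
    have h5 : (5 : ℝ) ≤ ((⌈y⌉₊ : ℕ) : ℝ) := hy5.trans (Nat.le_ceil y)
    have h5' : 5 ≤ ⌈y⌉₊ := by exact_mod_cast h5
    omega
  set tail := ∏ p ∈ (Nat.primesLE ⌊Real.sqrt q⌋₊).filter (fun p => s < p),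
    (1 - (polyRootCountMod ![rabinowitschPoly d] p : ℝ) / p) with htail
  have hfac : ∀ p ∈ (Nat.primesLE ⌊Real.sqrt q⌋₊).filter (fun p => s < p),
      0 < 1 - (polyRootCountMod ![rabinowitschPoly d] p : ℝ) / p := fun p hp =>
    one_sub_omega_div_pos hdq hq8 (Nat.prime_of_mem_primesLE (mem_filter.mp hp).1)
  have htail0 : 0 < tail := prod_pos hfac
  have hρ : gmRho d = (∏ p ∈ Nat.primesBelow ⌈y⌉₊,
      (1 - (polyRootCountMod ![rabinowitschPoly d] p : ℝ) / p)) * tail := by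
    rw [gmRho_eq_prod hq, prod_primesLE_eq_mul_prod_filter_lt hs, Nat.primesBelow_eq_primesLE_sub_one]
  -- `log tail ≥ -T - 16/(s+1) ≥ -T - 16/y`
  have hlogtail : Real.log tail = ∑ p ∈ (Nat.primesLE ⌊Real.sqrt q⌋₊).filter (fun p => s < p),
      Real.log (1 - (polyRootCountMod ![rabinowitschPoly d] p : ℝ) / p) :=
    Real.log_prod (fun p hp => (hfac p hp).ne')
  have h2 := (abs_le.mp (abs_sum_log_one_sub_omega_add_le hdq hq4 (s := s) (X := ⌊Real.sqrt q⌋₊) hs4)).1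
  rw [sum_add_distrib] at h2
  have hsy : y ≤ (s : ℝ) + 1 := by
    have : ((s : ℕ) : ℝ) + 1 = ((⌈y⌉₊ : ℕ) : ℝ) := by
      rw [hs_def]; push_cast [Nat.cast_sub (show 1 ≤ ⌈y⌉₊ by omega)]; ring
    rw [this]; exact Nat.le_ceil y
  have hy0 : 0 < y := by linarith
  have h16 : 16 / ((s : ℝ) + 1) ≤ 16 / y := div_le_div_of_nonneg_left (by norm_num) hy0 hsy
  have hlog_ge : -T - 16 / y ≤ Real.log tail := by rw [hlogtail]; linarith
  have htail_ge : Real.exp (-T - 16 / y) ≤ tail := by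
    rw [← Real.exp_log htail0]; exact Real.exp_le_exp.mpr hlog_ge
  have hV0 : 0 ≤ ∏ p ∈ Nat.primesBelow ⌈y⌉₊, (1 - (polyRootCountMod ![rabinowitschPoly d] p : ℝ) / p) :=
    prod_nonneg fun p hp => (one_sub_omega_div_pos hdq hq8 (Nat.prime_of_mem_primesBelow hp)).le
  calc ∏ p ∈ Nat.primesBelow ⌈y⌉₊, (1 - (polyRootCountMod ![rabinowitschPoly d] p : ℝ) / p)
      = (∏ p ∈ Nat.primesBelow ⌈y⌉₊, (1 - (polyRootCountMod ![rabinowitschPoly d] p : ℝ) / p)) *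
          tail * Real.exp (T + 16 / y) * (Real.exp (-T - 16 / y) / tail) := by
        rw [show -T - 16 / y = -(T + 16 / y) by ring, Real.exp_neg]
        field_simp
    _ ≤ (∏ p ∈ Nat.primesBelow ⌈y⌉₊, (1 - (polyRootCountMod ![rabinowitschPoly d] p : ℝ) / p)) *
          tail * Real.exp (T + 16 / y) * 1 := by
        refine mul_le_mul_of_nonneg_left ((div_le_one htail0).mpr htail_ge) ?_
        have := htail0.le
        positivity
    _ = gmRho d * Real.exp (T + 16 / y) := by rw [hρ, mul_one]

end Literature.Barriers.Parity
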